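import Mathlib
import HarnessLib
import HarnessLib.Audit
import Summits.ResolutionOfSingularities.Statement
import Literature.AlgebraicGeometry.Resolution.KummerNormalForm
import Literature.AlgebraicGeometry.Motives.CartierDivisor
import HarnessLib.Audit.Status.Attr

/-!
Route: WildQuotients

# Route WildQuotients — de Jong rescued — resolve wild quotients of REGULAR covers upstairs, get
Abramovich–Oort; with Picover, the summit over every field

RESCUER route (de Jong / Abramovich–de Jong / Gabber–Temkin alteration programme, repaired at its
recorded death point). It suffices
to show X = WildQuotientResolution ∧ Picover. WildQuotientResolution (WQ_p, the DODGE, new to the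
ledger): for every field k of
characteristic p, every Galois-type quotient X₁ of a REGULAR integral X′ by a finite group G (q : X′
→ X₁ finite, surjective,
generically étale, G-invariant, fibres = G-orbits; X₁ integral separated of finite type) has a
resolution. Picover (pAlteration
stmt-0554, shared verbatim): tops of finite radicial covers of regular varieties are resolvable. The
third crux is the REDUCTION,
filed per prime and summit-concluding (rev 2): SummitReduction — for every prime p, WQ_p ∧ PICover_p
⇒ ResolutionInChar p — whose
only unproved content is de Jong 1997 Thm 5.13 / Cor 5.15 typed as WQ → Pialt (the support
GaloisReduction, reaching the target
Pialt = Abramovich–Oort = pAlteration stmt-0555; its existential half is the support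
GaloisQuotientAlteration), the rest being
pAlteration's PROVED per-prime frame (Theorems.hasResolution_of_thesis +
PAlteration.DescentReducedToIntegral_holds; planner probe
rc 0: SummitReduction follows from `∀ p, WQ_p → PIAlt_p` and those two sorry-free theorems alone).
`closes` is pure logic over the
three cruxes and the route file imports NOTHING but the Statement (rev 2 cone repair: no Literature
/ Theorems module, so no
unproved named fact rides in; rev 1 had invoked the frame from Theorems.PAlterationAssembly2 /
…PicoverToRadicialBottom, whose
import closure carries 16 unproved facts — AbramovichOortConjecture, DeJong1996Strong*, Popescu1986,
…). Card realised:
tame-ghost-of-a-wild-action-v2 (spine; absorbs wild-quotients-divisorialize-fixed-scheme,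
wild-quotient-purification,
wild-quotient-peeling).
Lean: `WildQuotientResolution ∧ Picover` (decls of this file; WQ = ∀ p prime, ∀ k [Field k] [CharP k
p] (X′ X₁ : Scheme) (f : X₁ ⟶ Spec k) (q : X′ ⟶ X₁) (G) [Group G] [Finite G] (ρ : G →* Aut X′),
IsSeparated f → LocallyOfFiniteType f → QuasiCompact f → IsIntegral X₁ → IsIntegral X′ →
Scheme.IsRegular X′ → IsFinite q → Surjective q.base → (∃ U dense, Etale (q ∣_ U)) → (∀ g, (ρ g).hom
≫ q = q) → (∀ x y, q x = q y → ∃ g, (ρ g) x = y) → Scheme.HasResolution X₁)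

## Assembly
Pure logic, certified (Sketch.lean = the rev-2 file verbatim: lean check rc 0, 0 sorries, `closes`
axioms propext /
Classical.choice / Quot.sound, native audit codes [] with hypotheses = the three cruxes):
`closes hWQ hPc hSR := ResolutionOfSingularities_iff.mpr fun p hp => hSR p hp (hWQ p hp) (hPc p hp)`
— SummitReduction's two
antecedents are WildQuotientResolution and Picover with the prime fixed, verbatim, and
ResolutionOfSingularities_iff (Statement
file) folds `∀ p, ResolutionInChar p` back into the summit. The Assembly item (rev 0:
WildQuotientResolution → GaloisReduction → Picover → summit) is KEPT unchanged: it is true and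
provable now — `fun hWQ hGR hPc => Theorems.assembly_proof (fun p hp => ⟨hGR hWQ p hp, hPc p hp⟩)`
in a Theorems file importing Theorems.PAlterationAssembly — but it cannot be `closes` itself without
importing that module into THIS file (16 unproved facts in its import closure), so `closes` goes
through the crux SummitReduction, which carries the same frame prime by prime.

Rationale: WHY THIS LINE. Every alteration theorem stops at the same place: de Jong 1997 Cor 5.15
(doi:10.5802/aif.1575 p. 620) resolves X "up to quotient
singularities and a purely inseparable extension of R(X)"; Abramovich–de Jong toroidalise only tame
actions; Gabber (IllusieLaszloOrgogozo2014)
and Temkin2017 (arXiv:1508.06255 §1.3.5) "fix an l-Sylow subgroup ... the action of G_l is tame" and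
never quotient by the p-part; Bergh–Rydh
(arXiv:1905.00872 Thm 5) destackify tame stabilisers only, and AbramovichTemkinWlodarczyk2024
(arXiv:1906.07106 p. 4, fn.) name the residue — "destackification of a possibly wild Deligne–Mumford
stack and the resolution of a purely inseparable cover" — without a statement or a tool. The second
residue is pAlteration's Picover; the first had never been filed on this summit (pAlteration keeps
Pialt as a bare conjecture). This route files it as WQ, typed WITHOUT stacks or functoriality
(coarse resolution
of Galois-type quotients of regular schemes, any field — strictly weaker than wild
destackification), and certifies in Lean that WQ ∧ Picover
decide the summit over every field, imperfect ones included (the footnote needs k perfect). Imported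
area: modular invariant theory and equivariant birational geometry of a finite group on a REGULAR
scheme — blow-ups in regular G-stable centres are free, the terminal state is Király–Lütkebohmert's
criterion (KiralyLutkebohmert2013 Thm 2), the tame part is BerghRydh2019, and the line of attack is
the spine card's residue-weighted (Hirzebruch–Jung) equivariant blow-up, whose plain version
provably cycles for p ≥ 5. No other route puts a group where the singularity is; evidence that this
is where the classical programme dies: CossartPiltant2019 Rem 3.2's dim-4 obstruction polynomial
(Literature.Barriers.ResolutionOfSingularities.cpRemark32Poly) is the α_p-degeneration of
k[V₂⊕V₂]^{Z/p}, a wild quotient of A⁴ resolved upstairs by ONE blow-up (card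
wild-quotients-divisorialize-fixed-scheme).

RANKED CRUXES. #0 Pialt (target) — Abramovich–Oort (pAlteration stmt-0555, verbatim): every integral
separated finite-type scheme over a field of characteristic p admits a purely inseparable regular
alteration. Reached here as the support GaloisReduction applied to WildQuotientResolution; together
with Picover it is the summit (pAlteration's proved frame, consumed per prime inside the crux
SummitReduction). (why it might fail: Open since AbramovichOort2000 Q 2.13 (Temkin2013 Conj 1.3.1);
on this line it inherits WildQuotientResolution's risk — one Galois quotient X′/G of a regular
4-fold with no resolution kills Pialt-by-quotients and the summit at once.) [AbramovichOort2000,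
Temkin2013, DeJong1997]
#2 WildQuotientResolution (crux) — DODGE at the de Jong/Gabber death point: for every field k of
char p, every REGULAR integral X′ with an action ρ of a finite group G over an integral separated
finite-type X₁ — q : X′ → X₁ finite, surjective, étale over a dense open, ρ(g) ≫ q = q, fibres of q
= G-orbits (so X₁ = X′/G up to normalization) — the scheme X₁ has a resolution. Intended line (card
tame-ghost-of-a-wild-action-v2): equivariant residue-weighted blow-ups of X′ in fixed-point strata
until the augmentation ideals of the p-cyclic steps are invertible (KiralyLutkebohmert ⇒ regular
quotient), central series for p-groups, Bergh–Rydh for tame stabilisers. [difficulty: open-problem]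
(why it might fail: Unknown from dim 4 for every p; wild quotients are non-CM once codim(Fix) ≥ 3
(Ellingsrud–Skjelbred); the plain K–L blow-up game CYCLES for p ≥ 5 (card v2, kit j001294–j001301)
and the weighted kill is proved to first order only; non-solvable stabilisers (SL₂(F_p)) lack any
regularity criterion.) [DeJong1997, KiralyLutkebohmert2013, BerghRydh2019, LorenziniSchroer2019,
Peskin1983, AbramovichTemkinWlodarczyk2024, arXiv:2106.11526]
#3 Picover (crux) — INHERITED residue (pAlteration stmt-0554, shared verbatim; excluded from WQ by
the generically-étale clause): over any field k of char p, an integral X finite, universally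
injective and surjective over a regular integral separated finite-type Y has a resolution.
[difficulty: open-problem] (why it might fail: Open from dim 4, all p: a finite radicial cover of
regular Y is generically a tower t_i^p = f_i, Temkin's 'inseparable case, where all bad things can
happen' (Rem 1.3.5(iii)); kangaroo points and Hauser–Perlega unbounded residual order live in this
class; not-Picover is not-summit.) [Temkin2013, CossartPiltant2019,
Literature.Barriers.ResolutionOfSingularities.DimensionFourFrontier,
Literature.Barriers.ResolutionOfSingularities.hauserPerlega_mohProofBoundFails]
#4 SummitReduction (crux, NEW rev 2) — the de Jong REDUCTION, per prime and summit-concluding: ∀ p,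
WQ_p (verbatim) → PICover_p (verbatim) → ResolutionInChar p. Content: (1) DeJong1997 Thm 5.13 + Cor
5.15 pp. 619–620 (BerghRydh2019 Thm 1, any field; SGA1 V.1): X integral ⇒ Galois alteration X′
regular projective with G finite acting, X₁ := X′/G, q finite surjective generically étale (G ↦ its
faithful image), fibres = orbits, φ : X₁ → X proper surjective, finite + universally injective over
a dense open = support GaloisQuotientAlteration; (2) WQ_p resolves X₁, compose ⇒ PIAlt_p = support
GaloisReduction; (3) pAlteration's PROVED per-prime frame Theorems.hasResolution_of_thesis +
PAlteration.DescentReducedToIntegral_holds — planner Probe.lean rc 0: `(∀ p, WQ_p → PIAlt_p) →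
SummitReduction` by these two theorems ALONE. Consumed by `closes`; its prover's Theorems file may
import Theorems.PAlterationAssembly (proved cone) — only the ROUTE file stays import-clean. [deps:
WildQuotientResolution, Picover; supports GaloisReduction, GaloisQuotientAlteration] [difficulty:
XL] (why it might fail: Only as typed: X′/G as a SCHEME (X′ quasi-projective), generic étaleness
needs G ↦ its faithful image, de Jong's X′ is projective over a finite k′ ⊇ k with G acting
k-linearly, every field k; false only if dJ97 5.13/5.15 is mis-transcribed into WQ's binders; XL to
formalise.) [DeJong1997, DeJong1996, BerghRydh2019, SGA1, Temkin2013,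
Theorems.hasResolution_of_thesis, PAlteration.DescentReducedToIntegral_holds]
#9 GaloisReduction (support since rev 2; was crux #4) — WildQuotientResolution → Pialt: steps
(1)+(2) above (de Jong typed against WQ + composition with φ: proper ∘ proper, surjective, finite +
universally injective over a dense open; the sibling route WildQuotient files the composition as
PialtOfResolvedAlteration). Records the WQ ⇒ Abramovich–Oort link (closes pAlteration's target
stmt-0555 from WQ); a prover of SummitReduction proves it first; not a closes hypothesis.
[difficulty: XL] [DeJong1997, DeJong1996, BerghRydh2019, SGA1, Temkin2013]
#9 GaloisQuotientAlteration (support, restated rev 2) — KNOWN (DeJong1997 Thm 5.13 + Cor 5.15 pp.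
619–620; BerghRydh2019 Thm 1; SGA1 V.1 / MumfordAV1970 §7): every integral separated finite-type X
over k of char p admits a regular integral X′ with a finite group G acting, a finite surjective
generically étale G-invariant q : X′ → X₁ (fibres = G-orbits, X₁ = X′/G integral separated finite
type) and φ : X₁ → X proper, surjective, finite and universally injective over a dense open —
INLINED in Pialt's format so the route file imports no Literature…Alterations (open
AbramovichOortConjecture, unproved DeJong1996). [difficulty: XL] [DeJong1997, DeJong1996,
BerghRydh2019, SGA1, MumfordAV1970]
#9 KiralyLutkebohmert (support, PROVED in tree: Theorems.kiralyLutkebohmert_proof) — the terminal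
criterion of the upstairs game (Király–Lütkebohmert 2013 Thm 2): B regular local, σ of prime order
p, augmentation ideal (σb − b) principal ⇒ B^σ regular local. [KiralyLutkebohmert2013, Peskin1983]
#9 CyclicWildQuotient (support) — the wild ATOM in all dimensions: WildQuotientResolution for |G| =
p (dim ≤ 3 known by CossartPiltant2019; dim-2 structure Peskin1983, Lorenzini2014,
LorenziniSchroer2019; open from dim 4 — its dim ≤ 4 slice over perfect fields is the support
CyclicQuotientFourfolds). [difficulty: open-problem] [KiralyLutkebohmert2013, Lorenzini2014,
LorenziniSchroer2019, Peskin1983, CossartPiltant2019]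
#9 TameQuotientResolution (support) — KNOWN over perfect fields (BerghRydh2019 Thm 5; Buonerba
arXiv:1511.00550; toroidal methods): WildQuotientResolution for |G| prime to p, k perfect (X′
smooth, X′/G tame quotient singularities, X₁ resolved through its normalization X′/G); over
imperfect k the regular non-smooth case is not covered by the cited destackification. [difficulty:
L] [BerghRydh2019, AbramovichTemkinWlodarczyk2024,
Literature.AlgebraicGeometry.Resolution.BerghRydh2019_diagonalizableQuotientResolution]
#9 CyclicQuotientFourfolds (support since rev 5 — unused-crux repair 2026-08-17; filed rev 3 as crux
#5 on the judge's what_would_move_it: 'weighted K–L game proved terminating for Z/p on regular 3- or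
4-folds') — the FIRST OPEN CASE of WQ and the deliverable of that milestone, a SPECIAL CASE and
calibration target, NOT load-bearing for `closes`, typed in WQ's own binders plus (k perfect, |G| =
p, dim X₁ ≤ 4): every Galois-type quotient X₁ = X′/G of a REGULAR integral X′ over a perfect field
of char p with |G| = p and dim X₁ ≤ 4 has a resolution. dim ≤ 3 is CossartPiltant2019 (in tree
modulo the named fact: Negative.CounterexampleShape.wq_hasResolution_of_dim_le_three), so the
content is dim 4, the first open dimension of the summit, met by the wild atom; the intended proof
IS the milestone: card K1 (plain blow-ups of regular σ-stable strata monomialise I_σ) → K2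
(residue-weighted ghost kill; first theorem = support GhostRationality) → K3 (termination;
tame-cyclic output resolved torically / BerghRydh2019 Thm 5) on regular ≤ 4-folds, then
KiralyLutkebohmert (PROVED) chartwise. Certified (planner Sketch.lean + Mock.lean, rc 0):
WildQuotientResolution → it, CyclicWildQuotient → it (literal specialisations); ¬it →
¬WildQuotientResolution, ¬it → ¬ResolutionOfSingularities (KILL PATH to the rank-2 crux and the
summit); BC2 probe `it → summit` (exact?/simpa/aesop) FAILS — the summit's weakest open consequence
in this class, not its costume. Why support and not crux (rev 5): the summit and WQ quantify over
ALL dimensions, groups and fields, so a dim ≤ 4 / |G| = p / perfect-k consequence of WQ cannot feed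
`closes` (gate cone: not a binder, not glue, not a kill-path item) — the only 'glues' are `it → WQ`
(all of WQ's difficulty in costume) or a sector carving WQ ⇐ it ∧ WQ-minus-sector, which would burn
WQ's single split slot; that slot is reserved for lead c4's CERTIFIED decomposition PhaseZeroModel →
PClosedWQNormal → WQ (glue landed p142477, bounded-dimension twin GluedSplitDim p140132; crux
NOTES.md 'PROMOTE' — tenure decision), inside whose PClosedWQNormal lines the K–L game and this
milestone live. closes stays the certified pure-logic term over WQ/Picover/SummitReduction.
[difficulty: open-problem] (why it might fail: dim 4 open for every p; Yasuda arXiv:2107.07073 §9: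
non-linear wild quotients are where to hunt a counterexample to resolution; k[V₄]^{Z/p} already
non-CM; weighted game verified only by kit runs, to first order.) [KiralyLutkebohmert2013,
arXiv:2107.07073, CossartPiltant2019, BerghRydh2019, doi:10.2140/ant.2023.17.1017, Peskin1983, card
tame-ghost-of-a-wild-action-v2]
#9 JordanBlockFourfold (support, NEW rev 3) — the COMPUTED INSTANCE, first rung: for p ≥ 5, k
perfect, A⁴_k/⟨σ⟩ = Spec k[x₀..x₃]^σ for the 4×4 unipotent Jordan block (order p; fixed space of
codim 3 — by Ellingsrud–Skjelbred the unique non-Cohen–Macaulay linear Z/p-quotient of A⁴) has a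
resolution. The card's games ran exactly here: plain game cycles (kit j001300), hybrid
residue-weighted game terminates (j001394 T7, j001400); a proof is the milestone in its most
concrete form; no resolution of A⁴/V₄ found in print. Kill: Yasuda arXiv:2107.07073 Problem 5.1/§6 —
stringy point counts of A⁴/V₄ over F_q of non-rational shape or violating Poincaré duality exclude a
log resolution [difficulty: XL]
#9 GhostRationality (support, NEW rev 3, PROVABLE NOW, M) — the lever's first theorem (card fact
(R)), pure commutative algebra: B a local domain of char p, σ^p = 1, x₁..x_c ≠ 0 in 𝔪 with σ(x_i) =
x_i(1 + M u_i), M = ∏ x_j^{a_j}, σ(b) − b ∈ M·𝔪 for all b (bad monomial-phase point) ⇒ δ_i^p = δ_i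
γ^{p−1} in the residue field (δ_i = ū_i, γ = Σ a_j δ_j): the clock vector −δ/γ is F_p-rational, the
wild action is congruent to the tame ghost μ_p. Hand proof (planner): D = σ − 1, D(ab) = D(a)σ(b) +
aD(b), D^p = 0; D^j x_i = x_i M^j (∏_{l<j}(u_i + lγ) + 𝔪); j = p, domain ⇒ ∏_{l∈F_p}(δ_i + lγ) =
δ_i^p − δ_iγ^{p−1} = 0. Instance: L–S product point after one blow-up, δ = (−1, 1), a = (1, 0), γ =
−1.

TWO-LAYER PLAN. Foreseen glued splits (none filed now): WildQuotientResolution ⇐ CyclicFunctorial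
(Aut-equivariant resolution of X′/σ, σ of order p:
the atom WITH functoriality for automorphisms normalising σ) → PGroupPeeling (central series) →
WildByTame (O^{p′}(G_x) first, then
Bergh–Rydh on the tame quotient) → WildQuotientResolution (k = 3); CyclicFunctorial ⇐
Monomialisation of the augmentation ideal (card K1)
→ GhostKill (residue-weighted blow-up, card K2) → Termination + tame output (card K3) (k = 3, depth
1). NEW rev 3 (rev 5: now a support milestone): CyclicQuotientFourfolds ⇐ Monomialisation₄ (K1) →
GhostKill (K2; first lemma GhostRationality) → Termination₄ + tame output (K3) (k = 3) — to be
registered as a LINE on WildQuotientResolution (or on PClosedWQNormal once the tenure split is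
filed) (stubs in local algebra and blow-up charts: tree exists_isBlowup, IsBlowup.liftAction), NOT
as items; the dim-3 case of K3 (output known by CossartPiltant2019, mechanism not) is the natural
first stub wave; the mechanism-level `CyclicDivisorialModel` (plain K–L terminal state:
σ-equivariant proper birational REGULAR V → X′, augmentation ideal principal at every σ-fixed stalk,
σ-stable affine cover; elaborated in planner Sketch.lean) is the candidate transfer stub (with
KiralyLutkebohmert it yields the crux) and the object of the mechanism-level kill.

KILL CRITERIA. ¬WildQuotientResolution (a Galois-type quotient of a regular variety with no
resolution) is ¬summit: close everything `refuted`.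
A proof that every normal variety of char p is étale-locally (or up to finite birational maps) a
Galois quotient of a regular one would make
WQ the summit in costume — close as not-a-dodge and return the mechanism to pAlteration's Pialt as
crux ideas. Mechanism-level kill (pivot,
not closure): a Z/p-action on a regular 4-fold for which NO sequence of equivariant blow-ups in
regular (weighted) σ-stable centres makes
the augmentation ideal invertible although the quotient is resolvable — then K–L divisorialisation
is not the terminal state; pivot to
'resolve X′/σ by centres not pulled back from strata'. Pialt proved elsewhere (Temkin-style
globalisation) moots the WQ half (supersede);
Picover refuted ⇒ summit false. NEW rev 3: ¬CyclicQuotientFourfolds (a Z/p-quotient of a regular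
4-fold over a perfect field with no resolution; Yasuda arXiv:2107.07073 §9: hunt among non-linear
actions) ⇒ ¬WildQuotientResolution ⇒ ¬summit (certified): close `refuted`; ¬JordanBlockFourfold
likewise. ¬GhostRationality could only be a mis-typing of (R): drop and re-file. Mechanism-level
kill, now typed: ¬CyclicDivisorialModel (dim ≤ 4) while CyclicQuotientFourfolds stands ⇒ plain K–L
terminal state unreachable, the weighted/stacky output of K3 is essential (pivot of lines, not
closure).

NOT DECOMPOSED YET. The K–L game STUBS (monomial phase, residue vector, weighted charts) live in the
lines of WildQuotientResolution (and of PClosedWQNormal once split; the support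
CyclicQuotientFourfolds is their dim-4 cyclic milestone), not as items (definitions needed there:
augmentation-ideal sheaf / fixed-point scheme of a finite-order automorphism, monomial phase and
residue vector, weighted blow-up charts); the p-group peeling and the non-solvable-stabiliser
reduction (functoriality statements); tame destackification over IMPERFECT fields (regular
non-smooth X′); the inseparable twin of the game (card K4) belongs to Picover's lines (cards
alpha-p-to-mu-p-foliation-reduction, clean-differential).

TWIN ROUTE (for the novelty refuter / tenure planner): route-ResolutionOfSingularities-WildQuotient
(transfer lens, opened 3 min later) realises the same card with WQ over PERFECT fields via
Zariski-local charts Spec S^G and de Jong's theorem as a crux; this route types WQ over EVERY field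
with an explicit G-action on a regular (not necessarily smooth) X′. Same mechanism, different
typing; merging is a tenure decision.

CHEAPEST FALSIFIER. (i) Lookup, RUN 2026-08-16: is coarse resolution of wild quotients in dim ≥ 4
(or its impossibility) in print? zbMATH "wild quotient singularities positive characteristic" (15:
Obus–Wewers, Lorenzini ×3, Lorenzini–Schröer ×2, Peskin, Mitsui, Yasuda ×3), "crepant resolution
quotient variety positive characteristic" (7: Yamamoto arXiv:2106.11526, Toda–Yasuda, Yasuda), arXiv
(2: Obus–Wewers, Liedtke arXiv:2207.06286): all dim 2 / arithmetic surfaces / examples / stringy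
invariants — nothing decides WQ. (ii) Kit falsifier of the MECHANISM (card): hybrid K–L game on
A⁴/V₄ (p = 5) to depth 12 and one non-product Lorenzini–Schröer action in dim 3 — a recurring bad
point neither monomial-phase nor killed within two Loewy levels retires the line (not the crux).
(iii) In-Lean, RUN 2026-08-16 (rev 2): Sketch.lean (= the rev-2 route file) rc 0, 0 sorries, closes
axioms propext/choice/Quot.sound, audit codes []; Probe.lean proves `(∀ p, WQ_p → PIAlt_p) →
SummitReduction` from the two proved frame theorems (rc 0, 0 sorries) — the assembly is not where
this route can fail. Typing sanity of WQ: G = 1 (q finite generically étale of degree 1 ⇒ finite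
birational from regular X′ ⇒ q resolves X₁); generic stabilisers (fibres = orbits + generic
étaleness ⇒ K(X′)/K(X₁) Galois with group im ρ, X′/im ρ = normalisation of X₁). (iv) RUN 2026-08-17
(rev 3): Mock.lean = rendered route file + the three new items, lean check rc 0 (closes audit
unchanged: ok, hypotheses WQ/Picover/SummitReduction, codes []); Sketch.lean rc 0: specialisation +
kill-path certificates, BC2 probe fails as required. Cheapest kills of the new items:
JordanBlockFourfold — stringy point count of A⁴/V₄ over F_p (one kit job); GhostRationality —
instances p = 5, c = 2. Lookup 2026-08-17: crossref 'wild quotient' (Lorenzini 2013,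
Lorenzini–Schröer ANT 2023, Ito–Schröer 2015, Peskin 1983 — all dim 2); Yasuda arXiv:2107.07073 read
(§4, 5.1, §6, §9: resolvability of wild quotients open, no dim-4 result); galaxy --star all 'wild
quotient singularities in dimension three' (0); OpenAlex/S2 rate-limited.

NUMBERS. Known range: WQ holds in dim X₁ ≤ 3 for every p (CossartPiltant2019); K–L converse (regular
invariants ⇒ principal augmentation ideal) known for p ≤ 3 (KiralyLutkebohmert2013 after Conj 10);
card computations: plain equivariant game cycles
for p = 5, 7 to depth 8–11 (kit j001294–j001301), residue-weighted kill verified in dims 2–4, p = 5,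
7 (kit j001394, j001400). Items: 10 at open, 9 after rev 1, 10 after rev 2 (target Pialt; cruxes
WildQuotientResolution r2, Picover r3, SummitReduction r4; supports GaloisReduction,
GaloisQuotientAlteration, KiralyLutkebohmert (proved), CyclicWildQuotient, TameQuotientResolution;
Assembly (proved)). Rev 3 (judge repair): 13 items — cruxes 4 (+ CyclicQuotientFourfolds r5),
supports 7 (+ JordanBlockFourfold, GhostRationality); closes unchanged. Rev 5 (unused-crux repair):
13 items — cruxes 3 = exactly the closes hypotheses (WildQuotientResolution r2, Picover r3,
SummitReduction r4), CyclicQuotientFourfolds re-kinded crux→support (special case, out of the closes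
cone), supports 8; closes unchanged. Import cone: rev 1 = 183 project modules, 16 unproved named
facts; rev 2–3 = the Statement's own cone only.

DEFINITION REQUESTS. None (Mathlib + the Statement's base file: Scheme.IsRegular,
Scheme.HasResolution, ResolutionInChar, Etale, UniversallyInjective, CategoryTheory.Aut,
IsRegularLocalRing, RingHom.eqLocus; rev 3 adds only MvPolynomial, FixedPoints.subalgebra,
Subgroup.zpowers, IsLocalRing.residue, topologicalKrullDim — Mathlib). Layer 2 (with the first
split, not now): augmentation-ideal sheaf / fixed-point scheme of a finite-order automorphism;
quotient of a quasi-projective scheme by a finite group (would let GaloisQuotientAlteration say X₁ =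
X′/G on the nose). CONE HYGIENE wanted from librarians: move AbramovichOortConjecture out of
Alterations.lean into a leaf file; cut Theses.PAlteration's import of
Theorems.WeightedInvariantDescentReducedToIntegral (drags WeightedInvariant → AlterationsStrong into
every pAlteration-family Theorems module) — until then no route file here can invoke pAlteration's
proved frame without 16 unproved facts in its import cone (why the frame sits inside
SummitReduction).

Novelty: Searches (2026-08-16): `lit search --hybrid "resolution of singularities positive characteristic
program obstruction survey"` (15, none on
quotients); zbMATH "wild quotient singularities positive characteristic" (15), "crepant resolution
quotient variety positive characteristic"
(7), "Lorenzini wild quotient singularities of surfaces" (6, reviews read); arXiv "quotient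
singularities finite group characteristic p
resolution" (2); `lit galaxy search --star all "wild quotient singularities"` (1, irrelevant) and
`"quotient singularities in positive
characteristic"` (0); `lit read` doi:10.5802/aif.1575 pp. 16–23 (dJ97 5.3, 5.13, 5.15),
arXiv:1905.00872 pp. 4–5 (BR Thm 1, 5, 7),
arXiv:1906.07106 p. 4 (ATW footnote), arXiv:1508.06255 pp. 3–5 (Temkin §1.1.1, §1.3.5),
arXiv:1001.1945 pp. 1–4 (K–L Thm 2, Conj 10),
arXiv:2106.11526 abstract; the six route files; `ledger negatives` (0); cards
tame-ghost-of-a-wild-action-v2, wild-quotients-divisorialize-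
fixed-scheme, wild-quotient-purification, wild-quotient-peeling, tame-dejong,
dejong-four-equals-three-plus-one.
Nearest prior art found: AbramovichTemkinWlodarczyk2024 (arXiv:1906.07106 p. 4 fn.: the architecture
"wild destackification + p.i. covers",
perfect fields, no statement, no tool); DeJong1997 Cor 5.15 (the input); KiralyLutkebohmert2013
(criterion, game not analysed);
BerghRydh2019 Thm 5 (tame only); on the ledger, route pAlteration (Pialt kept as a bare crux, the
quotient sibling named and not filed)
and the spine card (mechani  [refs: 10.5802/aif.1575, 1905.00872, 1906.07106, 1508.06255, 1001.1945, 2106.11526, doi:10.5802/aif.1575, AbramovichTemkinWlodarczyk2024, DeJong1997, KiralyLutkebohmert2013, BerghRydh2019]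

Barriers (technique_class: wild-quotient-singularity, equivariant-weighted-blowup): - technique_class: wild-quotient-singularity, equivariant-weighted-blowup
- Literature.Barriers.ResolutionOfSingularities.DimensionFourFrontier: evaded in ARCHITECTURE — no
LU_4, no Zariski patching, no embedded resolution one dimension down: the alteration supplies a
regular cover and the problem becomes equivariant geometry on a REGULAR scheme; not evaded as
knowledge (WQ is open from dim 4); its witness cpRemark32Poly is a degenerate wild quotient of A⁴
resolved upstairs by one blow-up (card computation).
- Literature.Barriers.ResolutionOfSingularities.InseparableBaseChange: respected — WQ, the bridge
and closes are stated and proved over EVERY field with X′ regular (not smooth) and perform no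
ground-field extension (RadicialBottom is proved for all k); conceded: Bergh–Rydh's tame input wants
k perfect, so TameQuotientResolution is filed over perfect fields and imperfect-field tame
destackification is layer 2.
- Literature.Barriers.ResolutionOfSingularities.RegularNotGeometricallyRegular: same point —
regularity of X′ is never transported along a field extension in this route.
- Literature.Barriers.ResolutionOfSingularities.Narasimhan1983_noSmoothHypersurfaceThroughTopLocus:
not engaged — no hypersurface of maximal contact is chosen; centres are fixed-point strata of a
group acting on a regular scheme.
- Literature.Barriers.ResolutionOfSingularities.Hauser2003_kangarooShadeIncrease: outside its
technique class (no coefficient ideal, no residual order); the analogous risk —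

History (route lifecycle, newest last):
- 2026-08-16T15:38:14Z · rev 1: dropped PialtPicoverAssembly — glue repair (gate stamp glue.non-crux-hypothesis): `closes` now assumes the three CRUXES only (WildQuotientResolution, GaloisReduction, Picover) and INVOKES pAl (planner-rbadge-ResolutionOfSingularities-WildQ-646df16e-0)
- 2026-08-16T16:32:44Z · rev 2: restated GaloisQuotientAlteration (stmt-ResolutionOfSingularities-15642) — cone repair (rrepair, D-0023 Phase-C guardrail): the rev-1 import cone carried 16 unproved named facts (AbramovichOortConjecture, DeJong1996Projective/Induction (planner-rrepair-ResolutionOfSingularities-Wild-646df16e-0)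
- 2026-08-25T07:12:38Z · DORMANT — reconciler: no traction for 7.5 d (last activity item-evidence-added at 2026-08-17T19:04:39Z); parked, not closed — `ledger route dormant route-ResolutionOfSing (operator:999:4137533)
- 2026-08-26T16:26:27Z · REACTIVATED — dormant cleared (operator:999:1132932)

sub-problem: ResolutionOfSingularities · status: open · opened planner-plan-lens-ResolutionOfSingularities-rescuer-0 2026-08-16T15:14:56Z · rev 7 · ledger route-ResolutionOfSingularities-WildQuotients
GENERATED by the gate from the ledger (D-0016/17). Provers cite these decls: `theorem foo : Summit.ResolutionOfSingularities.ResolutionOfSingularities.Theses.WildQuotients.<Decl> := …` in Summits/ResolutionOfSingularities/ResolutionOfSingularities/Theorems/<Name>.lean.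
-/

namespace Summit.ResolutionOfSingularities.ResolutionOfSingularities.Theses.WildQuotients

open scoped BigOperators Topology Manifold Classical MeasureTheory ProbabilityTheory Matrix InnerProductSpace ComplexConjugate ContinuousMap
open Filter Set Function TopologicalSpace MeasureTheory

attribute [summit_statement] _root_.ResolutionOfSingularities

/-- item stmt-ResolutionOfSingularities-0555 · target · rank 0 · open · by planner
why it might fail: Open since AbramovichOort2000 Q 2.13 (Temkin2013 Conj 1.3.1); on this line it inherits WildQuotientResolution's risk — one Galois quotient X′/G of a regular 4-fold with no resolution kills Pialt-by-quotients and the summit at once.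
sources: AbramovichOort2000, Temkin2013, DeJong1997
PIAlt_p: every integral separated finite-type scheme over a field of char p admits a purely
inseparable regular alteration (Temkin2013 Conjecture 1.3.1 = Abramovich-Oort 2.9). Known locally
along every valuation: Temkin2013 Thm 1.3.2; known with p-power (not purely inseparable) degree:
Temkin2017 Thm 1.2.5. -/
@[route_item "route-ResolutionOfSingularities-WildQuotients", crux]
def Pialt : Prop :=
  ∀ p : ℕ, p.Prime → ∀ (k : Type) [Field k] [CharP k p] (X : AlgebraicGeometry.Scheme.{0}) (f : X ⟶ AlgebraicGeometry.Spec (.of k)), AlgebraicGeometry.IsSeparated f → AlgebraicGeometry.LocallyOfFiniteType f → AlgebraicGeometry.QuasiCompact f → AlgebraicGeometry.IsIntegral X → ∃ (X' : AlgebraicGeometry.Scheme.{0}) (g : X' ⟶ X), AlgebraicGeometry.IsProper g ∧ AlgebraicGeometry.IsIntegral X' ∧ Literature.AlgebraicGeometry.Resolution.Scheme.IsRegular X' ∧ Function.Surjective g.base ∧ ∃ U : X.Opens, Dense (U : Set X) ∧ AlgebraicGeometry.IsFinite (AlgebraicGeometry.morphismRestrict g U) ∧ AlgebraicGeometry.UniversallyInjective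 (AlgebraicGeometry.morphismRestrict g U)

/-- item stmt-ResolutionOfSingularities-15640 · crux · rank 2 · open · by planner
why it might fail: Unknown from dim 4 for every p; wild quotients are non-CM once codim(Fix) ≥ 3 (Ellingsrud–Skjelbred); the plain K–L blow-up game CYCLES for p ≥ 5 (card v2, kit j001294–j001301) and the weighted kill is proved to first order only; non-solvable stabilisers (SL₂(F_p)) lack any regularity criterion.
sources: DeJong1997, KiralyLutkebohmert2013, BerghRydh2019, LorenziniSchroer2019, Peskin1983, AbramovichTemkinWlodarczyk2024
[crux] DODGE at the de Jong/Gabber death point: for every field k of char p, every REGULAR integral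
X′ with an action ρ of a finite group G over an integral separated finite-type X₁ — q : X′ → X₁
finite, surjective, étale over a dense open, ρ(g) ≫ q = q, fibres of q = G-orbits (so X₁ = X′/G up
to normalization) — the scheme X₁ has a resolution. Intended line (card
tame-ghost-of-a-wild-action-v2): equivariant residue-weighted blow-ups of X′ in fixed-point strata
until the augmentation ideals of the p-cyclic steps are invertible (KiralyLutkebohmert ⇒ regular
quotient), central series for p-groups, Bergh–Rydh for tame stabilisers. [difficulty: open-problem] -/
@[route_item "route-ResolutionOfSingularities-WildQuotients", crux]
def WildQuotientResolution : Prop :=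
  ∀ p : ℕ, p.Prime → ∀ (k : Type) [Field k] [CharP k p] (X' X₁ : AlgebraicGeometry.Scheme.{0}) (f : X₁ ⟶ AlgebraicGeometry.Spec (.of k)) (q : X' ⟶ X₁) (G : Type) [Group G] [Finite G] (ρ : G →* CategoryTheory.Aut X'), AlgebraicGeometry.IsSeparated f → AlgebraicGeometry.LocallyOfFiniteType f → AlgebraicGeometry.QuasiCompact f → AlgebraicGeometry.IsIntegral X₁ → AlgebraicGeometry.IsIntegral X' → Literature.AlgebraicGeometry.Resolution.Scheme.IsRegular X' → AlgebraicGeometry.IsFinite q → Function.Surjective q.base → (∃ U : X₁.Opens, Dense (U : Set X₁) ∧ AlgebraicGeometry.Etale (AlgebraicGeometry.morphismRestrict q U)) → (∀ g : G, CategoryTheory.CategoryStruct.comp (ρ g).hom q = q) → (∀ x y : X', q.base x = q.base y → ∃ g : G, (ρ g).hom.base x = y) → Literature.AlgebraicGeometry.Resolution.Scheme.HasResolution X₁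

/-- item stmt-ResolutionOfSingularities-0554 · crux · rank 3 · open · by planner
why it might fail: Open from dim 4, all p: a finite radicial cover of regular Y is generically a tower t_i^p = f_i, Temkin's 'inseparable case, where all bad things can happen' (Rem 1.3.5(iii)); kangaroo points and Hauser–Perlega unbounded residual order live in this class; not-Picover is not-summit.
sources: Temkin2013, CossartPiltant2019, Literature.Barriers.ResolutionOfSingularities.DimensionFourFrontier, Literature.Barriers.ResolutionOfSingularities.hauserPerlega_mohProofBoundFails
PICover_p: over any field k of char p, if Y is a regular integral separated finite-type k-scheme and
g : X -> Y is finite, universally injective (radicial) and surjective with X integral, then X has a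
resolution. The 'inseparable case' (Temkin2013 Rem 1.3.4(iii)); open in dim >= 4. -/
@[route_item "route-ResolutionOfSingularities-WildQuotients", crux]
def Picover : Prop :=
  ∀ p : ℕ, p.Prime → ∀ (k : Type) [Field k] [CharP k p] (Y X : AlgebraicGeometry.Scheme.{0}) (f : Y ⟶ AlgebraicGeometry.Spec (.of k)) (g : X ⟶ Y), AlgebraicGeometry.IsSeparated f → AlgebraicGeometry.LocallyOfFiniteType f → AlgebraicGeometry.QuasiCompact f → AlgebraicGeometry.IsIntegral Y → Literature.AlgebraicGeometry.Resolution.Scheme.IsRegular Y → AlgebraicGeometry.IsIntegral X → AlgebraicGeometry.IsFinite g → AlgebraicGeometry.UniversallyInjective g → Function.Surjective g.base → Literature.AlgebraicGeometry.Resolution.Scheme.HasResolution X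

/-- item stmt-ResolutionOfSingularities-16324 · crux · rank 4 · open · by planner
why it might fail: Only as typed: X′/G as a SCHEME (X′ quasi-projective), generic étaleness needs G ↦ its faithful image, de Jong's X′ is projective over a finite k′ ⊇ k with G acting k-linearly, every field k; false only if dJ97 5.13/5.15 is mis-transcribed into WQ's binders; XL to formalise.
sources: DeJong1997 (doi:10.5802/aif.1575 Thm 5.13, Cor 5.15 pp. 619–620), DeJong1996, BerghRydh2019 (arXiv:1905.00872 Thm 1), SGA1 (Exp. V §1–2: quotient by a finite group; étale over the free locus), Temkin2013 (arXiv:0804.1554v3 Conj 1.3.1, Rem 1.3.5), Summit.ResolutionOfSingularities.ResolutionOfSingularities.Theorems.hasResolution_of_thesis (PROVED, Theorems/PAlterationAssembly.lean)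
[crux] The de Jong REDUCTION, per prime and summit-concluding (rev 2; the consumed crux, replacing
GaloisReduction as a closes hypothesis): for every prime p, if every Galois-type quotient X₁ = X′/G
of a REGULAR integral X′ over a field of characteristic p has a resolution (WQ_p, the body of
WildQuotientResolution verbatim) and every finite radicial cover of a regular variety in
characteristic p has a resolution (PICover_p, the body of Picover verbatim), then ResolutionInChar
p: every reduced separated scheme of finite type over every field of characteristic p has a
resolution. Proof plan: (1) DeJong1997 Thm 5.13 + Cor 5.15 (doi:10.5802/aif.1575 pp. 619–620;
BerghRydh2019 Thm 1, any field; finite group quotients SGA1 V.1): for X integral, a Galois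
alteration X′ regular projective with G finite acting, X₁ := X′/G (X′ quasi-projective), q : X′ → X₁
finite surjective generically étale (G ↦ its faithful image) with fibres = orbits, φ : X₁ → X proper
surjective, finite + universally injective over a dense open — the support GaloisQuotientAlteration;
(2) WQ_p resolves X₁; composing with φ gives PIAlt_p for X — the support GaloisReduction
(WildQuotientResolution → Pialt, the target); (3) -/
@[route_item "route-ResolutionOfSingularities-WildQuotients", crux]
def SummitReduction : Prop :=
  ∀ p : ℕ, p.Prime → (∀ (k : Type) [Field k] [CharP k p] (X' X₁ : AlgebraicGeometry.Scheme.{0}) (f : X₁ ⟶ AlgebraicGeometry.Spec (.of k)) (q : X' ⟶ X₁) (G : Type) [Group G] [Finite G] (ρ : G →* CategoryTheory.Aut X'), AlgebraicGeometry.IsSeparated f → AlgebraicGeometry.LocallyOfFiniteType f → AlgebraicGeometry.QuasiCompact f → AlgebraicGeometry.IsIntegral X₁ → AlgebraicGeometry.IsIntegral X' → Literature.AlgebraicGeometry.Resolution.Scheme.IsRegular X' → AlgebraicGeometry.IsFinite q → Function.Surjective q.base → (∃ U : X₁.Opens, Dense (U : Set X₁) ∧ AlgebraicGeometry.Etale (AlgebraicGeometry.morphismRestrict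 q U)) → (∀ g : G, CategoryTheory.CategoryStruct.comp (ρ g).hom q = q) → (∀ x y : X', q.base x = q.base y → ∃ g : G, (ρ g).hom.base x = y) → Literature.AlgebraicGeometry.Resolution.Scheme.HasResolution X₁) → (∀ (k : Type) [Field k] [CharP k p] (Y X : AlgebraicGeometry.Scheme.{0}) (f : Y ⟶ AlgebraicGeometry.Spec (.of k)) (g : X ⟶ Y), AlgebraicGeometry.IsSeparated f → AlgebraicGeometry.LocallyOfFiniteType f → AlgebraicGeometry.QuasiCompact f → AlgebraicGeometry.IsIntegral Y → Literature.AlgebraicGeometry.Resolution.Scheme.IsRegular Y → AlgebraicGeometry.IsIntegral X → AlgebraicGeometry.IsFinite g → AlgebraicGeometry.UniversallyInjective g → Function.Surjective g.base → Literature.AlgebraicGeometry.Resolution.Scheme.HasResolution X) → Literature.AlgebraicGeometry.Resolution.ResolutionInChar.{0} p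

/-- item stmt-ResolutionOfSingularities-15641 · support · rank 4 · open · by planner
why it might fail: Only as typed: the SCHEME quotient X′/G with q finite, fibres = orbits and generic étaleness needs de Jong's X′ quasi-projective (true via the projective reduction inside dJ97 5.13's proof, restricted over X) and G replaced by its faithful image; every field k; XL to formalise.
sources: DeJong1997 (doi:10.5802/aif.1575 Thm 5.13, Cor 5.15 pp. 619–620), DeJong1996, BerghRydh2019 (arXiv:1905.00872 Thm 1), SGA1 (Exp. V §1), Temkin2013
[crux] The de Jong REDUCTION (DeJong1997 Thm 5.13 + Cor 5.15 pp. 619–620, Bergh–Rydh Thm 1,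
quotients by finite groups SGA1 V.1, plus composition of a resolution with a purely inseparable
alteration): WildQuotientResolution → Pialt. For X integral separated of finite type over k take de
Jong's Galois alteration (X′ regular with G acting, X′/G → X generically radicial), form X₁ := X′/G
(X′ quasi-projective), resolve X₁ by WQ and compose. Its existential content is filed separately as
the support GaloisQuotientAlteration (the fact as typed); this item is what the deciding theorem
consumes. [deps: WildQuotientResolution] [difficulty: XL] -/
@[route_item "route-ResolutionOfSingularities-WildQuotients"]
def GaloisReduction : Prop :=
  WildQuotientResolution → Pialt

/-- item stmt-ResolutionOfSingularities-17941 · support · rank 5 · open · by planner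
why it might fail: Dim 4 is open for every p (DimensionFourFrontier); Yasuda arXiv:2107.07073 §9 names non-linear wild quotients as the place to hunt a counterexample to resolution; k[V4]^(Z/p) is already non-CM; the weighted K-L game is verified only by kit runs (j001394/j001400) and to first order.
sources: KiralyLutkebohmert2013 (doi:10.2140/ant.2013.7.63 Thm 2, §4), arXiv:2107.07073 (Yasuda 2021, Problem 5.1, §6, §9), CossartPiltant2019 (Thm 1.1: dim ≤ 3), BerghRydh2019 (arXiv:1905.00872 Thm 5), doi:10.2140/ant.2023.17.1017 (Lorenzini–Schröer 2023), Peskin1983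
[crux] FIRST OPEN CASE of WildQuotientResolution and the deliverable of the judge's milestone
('weighted Király–Lütkebohmert game proved terminating for Z/p on regular 3- or 4-folds'; judge
repair 2026-08-17): over a PERFECT field k of characteristic p, every Galois-type quotient X₁ of a
REGULAR integral X′ by a group G of ORDER p — q : X′ → X₁ finite, surjective, étale over a dense
open, ρ(g) ≫ q = q, fibres of q = G-orbits, X₁ integral separated of finite type — with dim X₁ ≤ 4
has a resolution. Typed as WildQuotientResolution's body with three extra hypotheses (k perfect,
Nat.card G = p, topologicalKrullDim X₁ ≤ 4), so it is a LITERAL specialisation of the rank-2 crux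
and of the support CyclicWildQuotient (planner Sketch.lean, lean check rc 0: WildQuotientResolution
→ this, CyclicWildQuotient → this), and its negation refutes the crux AND the summit (¬this →
¬WildQuotientResolution, ¬this → ¬ResolutionOfSingularities, certified; cf.
Theorems…WildQuotientResolution.Negative.CounterexampleShape): the kill path of the route's cheapest
genuine counterexample. dim X₁ ≤ 3 holds by CossartPiltant2019 (in tree modulo the named fact:
Negative.CounterexampleShape.wq_hasResolution_of_dim_l -/
@[route_item "route-ResolutionOfSingularities-WildQuotients", crux (experiment := "instrument: ted; context-free InsertionStable stubs REFUTED as typed (#5f, rung B); InvariantCofinality3 refuted (census g28); res-idea reduction rows …") (source := "director RESOLUTION l.99, 2026-09-01")]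
def CyclicQuotientFourfolds : Prop :=
  ∀ p : ℕ, p.Prime → ∀ (k : Type) [Field k] [CharP k p] [PerfectField k] (X' X₁ : AlgebraicGeometry.Scheme.{0}) (f : X₁ ⟶ AlgebraicGeometry.Spec (.of k)) (q : X' ⟶ X₁) (G : Type) [Group G] [Finite G] (ρ : G →* CategoryTheory.Aut X'), Nat.card G = p → AlgebraicGeometry.IsSeparated f → AlgebraicGeometry.LocallyOfFiniteType f → AlgebraicGeometry.QuasiCompact f → AlgebraicGeometry.IsIntegral X₁ → AlgebraicGeometry.IsIntegral X' → Literature.AlgebraicGeometry.Resolution.Scheme.IsRegular X' → AlgebraicGeometry.IsFinite q → Function.Surjective q.base → (∃ U : X₁.Opens, Dense (U : Set X₁) ∧ AlgebraicGeometry.Etale (AlgebraicGeometry.morphismRestrict q U)) → (∀ g : G, CategoryTheory.CategoryStruct.comp (ρ g).hom q = q) → (∀ x y : X', q.base x = q.base y → ∃ g : G, (ρ g).hom.base x = y) → topologicalKrullDim X₁ ≤ 4 → Literature.AlgebraicGeometry.Resolution.Scheme.HasResolution X₁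

/-- item stmt-ResolutionOfSingularities-15643 · support · rank 9 · closed · proved by Summit.ResolutionOfSingularities.ResolutionOfSingularities.Theorems.kiralyLutkebohmert_proof @ bbdc3d5685b3 (prover) · by planner
sources: KiralyLutkebohmert2013, Peskin1983
[support] KNOWN terminal criterion of the upstairs game (Király–Lütkebohmert 2013 Thm 2,
(a)⇒(b)⇒(c)⇒(d); tame or wild): for a regular local ring B and a ring automorphism σ of prime order
p, if the augmentation ideal (σb − b : b ∈ B) is principal then the fixed ring B^σ is a regular
local ring. [difficulty: L] -/
@[route_item "route-ResolutionOfSingularities-WildQuotients"]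
def KiralyLutkebohmert : Prop :=
  ∀ p : ℕ, p.Prime → ∀ (B : Type) [CommRing B] [IsRegularLocalRing B] (σ : B ≃+* B), σ ≠ RingEquiv.refl B → σ ^ p = RingEquiv.refl B → (Ideal.span (Set.range fun b : B => σ b - b)).IsPrincipal → IsRegularLocalRing ((σ : B →+* B).eqLocus (RingHom.id B))

-- `KiralyLutkebohmert` holds: proved by `Summit.ResolutionOfSingularities.ResolutionOfSingularities.Theorems.kiralyLutkebohmert_proof` @ bbdc3d5685b3 (its module imports this route file, so no `_holds` link can be stated here).

/-- item stmt-ResolutionOfSingularities-15644 · support · rank 9 · open · by planner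
sources: KiralyLutkebohmert2013, Lorenzini2014, LorenziniSchroer2019, Peskin1983, CossartPiltant2019
[support] The wild ATOM (calibration target for mechanism seats): WildQuotientResolution for G of
order p. Known in dim ≤ 3 (CossartPiltant2019 resolves every variety there); dim-2 structure theory
Peskin1983, Lorenzini2014, LorenziniSchroer2019; open from dim 4. [difficulty: open-problem] -/
@[route_item "route-ResolutionOfSingularities-WildQuotients", crux]
def CyclicWildQuotient : Prop :=
  ∀ p : ℕ, p.Prime → ∀ (k : Type) [Field k] [CharP k p] (X' X₁ : AlgebraicGeometry.Scheme.{0}) (f : X₁ ⟶ AlgebraicGeometry.Spec (.of k)) (q : X' ⟶ X₁) (G : Type) [Group G] [Finite G] (ρ : G →* CategoryTheory.Aut X'), Nat.card G = p → AlgebraicGeometry.IsSeparated f → AlgebraicGeometry.LocallyOfFiniteType f → AlgebraicGeometry.QuasiCompact f → AlgebraicGeometry.IsIntegral X₁ → AlgebraicGeometry.IsIntegral X' → Literature.AlgebraicGeometry.Resolution.Scheme.IsRegular X' → AlgebraicGeometry.IsFinite q → Function.Surjective q.base → (∃ U : X₁.Opens, Dense (U : Set X₁) ∧ AlgebraicGeometry.Etale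 (AlgebraicGeometry.morphismRestrict q U)) → (∀ g : G, CategoryTheory.CategoryStruct.comp (ρ g).hom q = q) → (∀ x y : X', q.base x = q.base y → ∃ g : G, (ρ g).hom.base x = y) → Literature.AlgebraicGeometry.Resolution.Scheme.HasResolution X₁

/-- item stmt-ResolutionOfSingularities-15645 · support · rank 9 · open · by planner
sources: BerghRydh2019, AbramovichTemkinWlodarczyk2024, Literature.AlgebraicGeometry.Resolution.BerghRydh2019_diagonalizableQuotientResolution
[support] KNOWN over perfect fields (BerghRydh2019 Thm 5; Buonerba arXiv:1511.00550; toroidal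
methods): WildQuotientResolution for |G| prime to p and k perfect — X′ regular = smooth, X′/G has
finite tame quotient singularities, and X₁ is resolved through its normalization X′/G. Filed over
perfect k only: over imperfect k the regular non-smooth case is not covered by the cited
destackification. [difficulty: L] -/
@[route_item "route-ResolutionOfSingularities-WildQuotients"]
def TameQuotientResolution : Prop :=
  ∀ p : ℕ, p.Prime → ∀ (k : Type) [Field k] [CharP k p] [PerfectField k] (X' X₁ : AlgebraicGeometry.Scheme.{0}) (f : X₁ ⟶ AlgebraicGeometry.Spec (.of k)) (q : X' ⟶ X₁) (G : Type) [Group G] [Finite G] (ρ : G →* CategoryTheory.Aut X'), Nat.Coprime (Nat.card G) p → AlgebraicGeometry.IsSeparated f → AlgebraicGeometry.LocallyOfFiniteType f → AlgebraicGeometry.QuasiCompact f → AlgebraicGeometry.IsIntegral X₁ → AlgebraicGeometry.IsIntegral X' → Literature.AlgebraicGeometry.Resolution.Scheme.IsRegular X' → AlgebraicGeometry.IsFinite q → Function.Surjective q.base → (∃ U : X₁.Opens, Dense (U : Set X₁) ∧ AlgebraicGeometry.Etale (AlgebraicGeometry.morphismRestrict q U)) → (∀ g : G, CategoryTheory.CategoryStruct.comp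 (ρ g).hom q = q) → (∀ x y : X', q.base x = q.base y → ∃ g : G, (ρ g).hom.base x = y) → Literature.AlgebraicGeometry.Resolution.Scheme.HasResolution X₁

-- earlier GaloisQuotientAlteration (stmt-ResolutionOfSingularities-15642, replaced 2026-08-16T16:32:44Z -> stmt-ResolutionOfSingularities-16323): retired by None — ∀ p : ℕ, p.Prime → ∀ (k : Type) [Field k] [CharP k p] (X : AlgebraicGeometry.Scheme.{0}) (f : X ⟶ AlgebraicGeometry.Spec (.of k)), AlgebraicGeometry.IsSeparated f → AlgebraicGeometry.LocallyOfFiniteType f → AlgebraicGeometry.QuasiCompact 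
/-- item stmt-ResolutionOfSingularities-16323 · support · rank 9 · open · by planner
sources: DeJong1997, DeJong1996, BerghRydh2019, SGA1, MumfordAV1970
[support] KNOWN (de Jong 1997 Thm 5.13 + Cor 5.15, doi:10.5802/aif.1575 pp. 619–620; Bergh–Rydh Thm
1; quotients of quasi-projective schemes by finite groups, SGA1 V.1 / MumfordAV1970 §7): every
integral separated finite-type X over k of char p admits a regular integral X′ with a finite group G
acting, a finite surjective generically étale G-invariant q : X′ → X₁ with fibres = G-orbits onto an
integral separated finite-type X₁ (= X′/G), and φ : X₁ → X proper, surjective, finite and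
universally injective over a dense open of X — a purely inseparable alteration, INLINED in Pialt's
format (rev 2 cone repair: no `IsPurelyInseparableAlteration`, whose module Literature…Alterations
carries the open AbramovichOortConjecture and the unproved DeJong1996). With WildQuotientResolution
and composition it gives GaloisReduction. [difficulty: XL] -/
@[route_item "route-ResolutionOfSingularities-WildQuotients", crux]
def GaloisQuotientAlteration : Prop :=
  ∀ p : ℕ, p.Prime → ∀ (k : Type) [Field k] [CharP k p] (X : AlgebraicGeometry.Scheme.{0}) (f : X ⟶ AlgebraicGeometry.Spec (.of k)), AlgebraicGeometry.IsSeparated f → AlgebraicGeometry.LocallyOfFiniteType f → AlgebraicGeometry.QuasiCompact f → AlgebraicGeometry.IsIntegral X → ∃ (X' X₁ : AlgebraicGeometry.Scheme.{0}) (q : X' ⟶ X₁) (φ : X₁ ⟶ X) (G : Type) (_ : Group G) (_ : Finite G) (ρ : G →* CategoryTheory.Aut X'), AlgebraicGeometry.IsSeparated (CategoryTheory.CategoryStruct.comp φ f) ∧ AlgebraicGeometry.LocallyOfFiniteType (CategoryTheory.CategoryStruct.comp φ f) ∧ AlgebraicGeometry.QuasiCompact (CategoryTheory.CategoryStruct.comp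 φ f) ∧ AlgebraicGeometry.IsIntegral X₁ ∧ AlgebraicGeometry.IsIntegral X' ∧ Literature.AlgebraicGeometry.Resolution.Scheme.IsRegular X' ∧ AlgebraicGeometry.IsFinite q ∧ Function.Surjective q.base ∧ (∃ U : X₁.Opens, Dense (U : Set X₁) ∧ AlgebraicGeometry.Etale (AlgebraicGeometry.morphismRestrict q U)) ∧ (∀ g : G, CategoryTheory.CategoryStruct.comp (ρ g).hom q = q) ∧ (∀ x y : X', q.base x = q.base y → ∃ g : G, (ρ g).hom.base x = y) ∧ AlgebraicGeometry.IsProper φ ∧ Function.Surjective φ.base ∧ ∃ V : X.Opens, Dense (V : Set X) ∧ AlgebraicGeometry.IsFinite (AlgebraicGeometry.morphismRestrict φ V) ∧ AlgebraicGeometry.UniversallyInjective (AlgebraicGeometry.morphismRestrict φ V)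

/-- item stmt-ResolutionOfSingularities-17942 · support · rank 9 · open · by planner
sources: arXiv:2107.07073 (Yasuda 2021, Problem 5.1, §6, §9), KiralyLutkebohmert2013, card tame-ghost-of-a-wild-action-v2 (kit j001300, j001394 T7, j001400), Peskin1983
[support] The COMPUTED INSTANCE of CyclicQuotientFourfolds and first rung for provers and kit: for
every prime p ≥ 5 and perfect field k of characteristic p, the linear quotient A⁴_k/⟨σ⟩ = Spec
k[x₀,x₁,x₂,x₃]^σ by the 4×4 unipotent Jordan block σ (the k-algebra automorphism x₀ ↦ x₀, x₁ ↦ x₁ +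
x₀, x₂ ↦ x₂ + x₁, x₃ ↦ x₃ + x₂; (σ − 1)⁴ = 0 and p ≥ 5 give σ^p = 1, so ⟨σ⟩ = Subgroup.zpowers σ ≅
Z/p and the invariant ring is k[V₄]^{Z/p}, V₄ the indecomposable 4-dimensional Z/p-module) has a
resolution. σ fixes a space of codimension 3, so by Ellingsrud–Skjelbred (k[V]^{Z/p} Cohen–Macaulay
iff codim V^{Z/p} ≤ 2) this is the unique NON-Cohen–Macaulay linear Z/p-quotient of A⁴ — the
smallest genuinely wild 4-fold quotient singularity (singular locus = image of the fixed line). The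
spine card's games were run exactly here: the plain Király–Lütkebohmert blow-up game CYCLES (kit
j001300, corner δ = (2,2,4)), the hybrid residue-weighted game TERMINATES (kit j001394 battery T7
weights (1,1,2); j001400: GF(p)-rational bad points, truncation-trusted) — turning that run into a
proof is the judge's milestone in its most concrete form. No resolution of A⁴/V₄ found in print
(route novelty searches 202 -/
@[route_item "route-ResolutionOfSingularities-WildQuotients"]
def JordanBlockFourfold : Prop :=
  ∀ p : ℕ, p.Prime → 5 ≤ p → ∀ (k : Type) [Field k] [CharP k p] [PerfectField k] (σ : MvPolynomial (Fin 4) k ≃ₐ[k] MvPolynomial (Fin 4) k), σ (MvPolynomial.X 0) = MvPolynomial.X 0 → σ (MvPolynomial.X 1) = MvPolynomial.X 1 + MvPolynomial.X 0 → σ (MvPolynomial.X 2) = MvPolynomial.X 2 + MvPolynomial.X 1 → σ (MvPolynomial.X 3) = MvPolynomial.X 3 + MvPolynomial.X 2 → Literature.AlgebraicGeometry.Resolution.Scheme.HasResolution (AlgebraicGeometry.Spec (CommRingCat.of (FixedPoints.subalgebra k (MvPolynomial (Fin 4) k) (Subgroup.zpowers σ))))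

/-- item stmt-ResolutionOfSingularities-17943 · support · rank 9 · closed · proved by Summit.ResolutionOfSingularities.ResolutionOfSingularities.Theorems.WildQuotients.GhostRationality.ghostRationality_proof @ 2f095c763735 (prover) · by planner
sources: card tame-ghost-of-a-wild-action-v2 (fact (R)), KiralyLutkebohmert2013 (doi:10.2140/ant.2013.7.63 §4)
[support] PROVABLE NOW (M-sized, pure commutative algebra over Mathlib): the RATIONALITY LAW (R) of
the tame ghost — the first theorem of the route's new lever (card tame-ghost-of-a-wild-action-v2,
critic-graded new-mechanism). Let B be a local domain of characteristic p and σ a ring automorphism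
with σ^p = 1; let x₁,…,x_c be nonzero elements of the maximal ideal 𝔪 with σ(x_i) = x_i·(1 + M·u_i),
where M = ∏_j x_j^{a_j}, and suppose σ(b) − b ∈ M·𝔪 for every b ∈ B (a BAD point in monomial phase:
the augmentation ideal is I_σ = M·R with R ⊆ 𝔪). Then in the residue field, with δ_i := ū_i and γ :=
Σ_j a_j δ_j: δ_i^p = δ_i·γ^{p−1} for every i. Consequences (card): γ ≠ 0 unless δ = 0, the clock
vector −δ/γ lies in F_p^c, and modulo M·𝔪 the wild action is congruent to the TAME GHOST μ_p acting
with weights −δ/γ — the weights of the residue-weighted blow-up of K2. HAND PROOF (planner-checked):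
put D := σ − 1; then D(ab) = D(a)σ(b) + a·D(b) and, σ commuting with 1 in characteristic p, D^p =
σ^p − 1 = 0. By induction on j, D^j(x_i) = x_i·M^j·(∏_{l<j}(u_i + l·γ̃) + m_j) with γ̃ = Σ a_j u_j
and m_j ∈ 𝔪, using σ(M) = M(1 + Mγ̃ + M²w), D(B) ⊆ M𝔪 and x_i ∈ 𝔪 (if all a_j = 0 then M = 1, σ(M) =
M an -/
@[route_item "route-ResolutionOfSingularities-WildQuotients"]
def GhostRationality : Prop :=
  ∀ p : ℕ, p.Prime → ∀ (B : Type) [CommRing B] [IsDomain B] [IsLocalRing B] [CharP B p] (σ : B ≃+* B), σ ^ p = RingEquiv.refl B → ∀ (c : ℕ) (x u : Fin c → B) (a : Fin c → ℕ), (∀ i, x i ≠ 0) → (∀ i, x i ∈ IsLocalRing.maximalIdeal B) → (∀ i, σ (x i) = x i * (1 + (∏ j, x j ^ a j) * u i)) → (∀ b : B, ∃ r ∈ IsLocalRing.maximalIdeal B, σ b - b = (∏ j, x j ^ a j) * r) → ∀ i, IsLocalRing.residue B (u i) ^ p = IsLocalRing.residue B (u i) * IsLocalRing.residue B (∑ j,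 (a j : B) * u j) ^ (p - 1)

-- `GhostRationality` holds: proved by `Summit.ResolutionOfSingularities.ResolutionOfSingularities.Theorems.WildQuotients.GhostRationality.ghostRationality_proof` @ 2f095c763735 (its module imports this route file, so no `_holds` link can be stated here).

/-- item stmt-ResolutionOfSingularities-18001 · support · rank 9 · open · by planner
why it might fail: Open n ≥ 4 (DimensionFourFrontier, base side): printed only n=2 over PERFECT k (Giraud 1983) and n=3 over k̄ (Cossart 1987); imperfect k untested from n=2; the STRICT form (toric directions = boundary components) costs extra codim-2 blow-ups; n ≥ 5 would need embedded resolution in dim n−2.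
sources: Giraud1983, Giraud1983Jung, CossartPiltant2008, Posva2024, HauserPerlega2019, Literature.Barriers.ResolutionOfSingularities.DimensionFourFrontier
[support — becomes the CRUX child of the Giraud split of Picover when the split is filed (gate:
--split is final-cycle-only; package Cruxes/Picover/SPLIT-giraud.md)] GIRAUD NORMAL FORM ON THE
SEPARATED REGULAR BASE — the research content of the live line giraud-separated-base, = its
registered stub `stub_giraudNormalFormSep` VERBATIM (skeleton v3, registry 2026-08-17T09:41Z; fully
qualified, Γ(W',U) expanded); shared in substance with 0557's `stub_cossartNormalForm` (affine base)
and RadicialJung.CleanModels (whose rider form it is: global snc boundary). For W regular integral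
separated finite type over k (char p) and L/K(W) purely inseparable of degree p: a proper birational
ρ : W' → W with W' integral REGULAR and an snc boundary E (HasSNC) such that every w' ∈ W' has an
affine neighbourhood U and a section a ∈ Γ(W', U) representing the class of L through ρ^♯ : K(W) ≅
K(W') (some y ∈ L ∖ K(W) with y^p = c, ρ^♯ c = germ of a) whose germ at EVERY point of U is
GiraudNormalFormAt: a = g^p + (∏ x_j^{B_j})^p·u with u wound-or-transversal
(IsWoundOrTransversalAt), or a = g^p + u·∏ x_j^{A_j} with u a unit and some p ∤ A_j (x_j = local
equations of the boundary components through the poin -/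
@[route_item "route-ResolutionOfSingularities-WildQuotients", crux]
def GiraudNormalFormSep : Prop :=
  ∀ p : ℕ, p.Prime → ∀ (k : Type) [Field k] [CharP k p] (W : AlgebraicGeometry.Scheme.{0}) [AlgebraicGeometry.IsIntegral W] (f : W ⟶ AlgebraicGeometry.Spec (.of k)) (L : Type) [Field L] [Algebra W.functionField L], AlgebraicGeometry.IsSeparated f → AlgebraicGeometry.LocallyOfFiniteType f → AlgebraicGeometry.QuasiCompact f → Literature.AlgebraicGeometry.Resolution.Scheme.IsRegular W → IsPurelyInseparable W.functionField L → Module.finrank W.functionField L = p → ∃ (W' : AlgebraicGeometry.Scheme.{0}) (_ : AlgebraicGeometry.IsIntegral W') (ρ : W' ⟶ W) (_ : AlgebraicGeometry.IsDominant ρ) (E : List W'.IdealSheafData), AlgebraicGeometry.IsProper ρ ∧ Literature.AlgebraicGeometry.Resolution.IsBirational ρ ∧ Literature.AlgebraicGeometry.Resolution.Scheme.IsRegular W' ∧ Literature.AlgebraicGeometry.Resolution.HasSNC E ∧ ∀ w' : W', ∃ (U : W'.affineOpens) (hU : w' ∈ (U : W'.Opens)) (a : W'.presheaf.obj (Opposite.op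 (U : W'.Opens))), (∃ (y : L) (c : W.functionField), y ∉ (algebraMap W.functionField L).range ∧ y ^ p = algebraMap W.functionField L c ∧ Literature.AlgebraicGeometry.Motives.RatFn.functionFieldMap ρ c = algebraMap (W'.presheaf.stalk w') W'.functionField (W'.presheaf.germ (U : W'.Opens) w' hU a)) ∧ ∀ (w'' : W') (hw'' : w'' ∈ (U : W'.Opens)), ∃ (r : ℕ) (D : Fin r → {D : W'.IdealSheafData // D ∈ E ∧ w'' ∈ D.support}) (x : Fin r → W'.presheaf.stalk w''), Function.Bijective D ∧ (∀ j, Literature.AlgebraicGeometry.Resolution.stalkIdeal (D j).1 w'' = Ideal.span {x j}) ∧ Literature.AlgebraicGeometry.Resolution.GiraudNormalFormAt p x (W'.presheaf.germ (U : W'.Opens) w'' hw'' a)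

/-- item stmt-ResolutionOfSingularities-18002 · support · rank 9 · open · by planner
sources: Kato1994, Niziol2006, Giraud1983
[support — child 2 of the pending Giraud split of Picover (package Cruxes/Picover/SPLIT-giraud.md)]
A GIRAUD-NORMAL-FORM MODEL RESOLVES THE RESIDUE UPSTAIRS (child 2 of the Giraud split; printed
algebra + ONE literature debt). For the data of GiraudNormalFormSep — W, L as there, ρ : W' → W
proper birational dominant with W' integral regular, snc boundary E, L a K(W')-algebra compatibly
with ρ^♯, the class in Giraud normal form locally uniformly on W' — the normalisation of W' in L has
a resolution. The conclusion is written with Mathlib's relative normalisation of Spec L → Spec K(W')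
→ W' (= Literature `normalizationIn W' L` definitionally, as in RadicialJung.CleanResolves rev 1) so
that the route file imports no fact-bearing module (cone stays clean). Proof plan = skeleton v3 of
line giraud-separated-base, all PROVED by lead a3 except the named fact: local log-regular charts
(localChartSep_woundCentre p150894, localChartSep_kummerCentre p151531,
sections_normalizationIn_of_root p150000, pointData_giraudNormalFormAt_of_pointwise p147267), the
atlas `endgameAtlasSep` (Y' = W'^L, ν = 𝟙) glued by logRegularAtlas_of_localLogRegularChart (Kato
(1.5)(S)), then Kato 1994 (10.4) / Nizioł 2 -/
@[route_item "route-ResolutionOfSingularities-WildQuotients"]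
def GiraudModelResolves : Prop :=
  ∀ p : ℕ, p.Prime → ∀ (k : Type) [Field k] [CharP k p] (W : AlgebraicGeometry.Scheme.{0}) [AlgebraicGeometry.IsIntegral W] (f : W ⟶ AlgebraicGeometry.Spec (.of k)) (L : Type) [Field L] [Algebra W.functionField L] (W' : AlgebraicGeometry.Scheme.{0}) [AlgebraicGeometry.IsIntegral W'] (ρ : W' ⟶ W) [AlgebraicGeometry.IsProper ρ] [AlgebraicGeometry.IsDominant ρ] (E : List W'.IdealSheafData) [Algebra W'.functionField L], AlgebraicGeometry.IsSeparated f → AlgebraicGeometry.LocallyOfFiniteType f → AlgebraicGeometry.QuasiCompact f → (algebraMap W'.functionField L).comp (Literature.AlgebraicGeometry.Motives.RatFn.functionFieldMap ρ) = algebraMap W.functionField L → Literature.AlgebraicGeometry.Resolution.IsBirational ρ → Literature.AlgebraicGeometry.Resolution.Scheme.IsRegular W' → Literature.AlgebraicGeometry.Resolution.HasSNC E → IsPurelyInseparable W.functionField L → Module.finrank W.functionField L = p → (∀ w' : W', ∃ (U : W'.affineOpens) (hU : w' ∈ (U : W'.Opens)) (a : W'.presheaf.obj (Opposite.op (U : W'.Opens))),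 (∃ (y : L) (c : W.functionField), y ∉ (algebraMap W.functionField L).range ∧ y ^ p = algebraMap W.functionField L c ∧ Literature.AlgebraicGeometry.Motives.RatFn.functionFieldMap ρ c = algebraMap (W'.presheaf.stalk w') W'.functionField (W'.presheaf.germ (U : W'.Opens) w' hU a)) ∧ ∀ (w'' : W') (hw'' : w'' ∈ (U : W'.Opens)), ∃ (r : ℕ) (D : Fin r → {D : W'.IdealSheafData // D ∈ E ∧ w'' ∈ D.support}) (x : Fin r → W'.presheaf.stalk w''), Function.Bijective D ∧ (∀ j, Literature.AlgebraicGeometry.Resolution.stalkIdeal (D j).1 w'' = Ideal.span {x j}) ∧ Literature.AlgebraicGeometry.Resolution.GiraudNormalFormAt p x (W'.presheaf.germ (U : W'.Opens) w'' hw'' a)) → Literature.AlgebraicGeometry.Resolution.Scheme.HasResolution ((CategoryTheory.CategoryStruct.comp (AlgebraicGeometry.Spec.map (CommRingCat.ofHom (algebraMap W'.functionField L) : W'.functionField ⟶ CommRingCat.of L)) (W'.fromSpecStalk (genericPoint W'))).normalization)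

/-- item stmt-ResolutionOfSingularities-15647 · assembly · rank 1 · closed · proved by Summit.ResolutionOfSingularities.ResolutionOfSingularities.Theorems.wildQuotients_assembly_proof @ 45d0da0f4e93 (prover) · by planner
sources: DeJong1997, Temkin2013, AbramovichTemkinWlodarczyk2024
[assembly] WildQuotientResolution → GaloisReduction → Picover → ResolutionOfSingularities. -/
@[route_item "route-ResolutionOfSingularities-WildQuotients"]
def Assembly : Prop :=
  WildQuotientResolution → GaloisReduction → Picover → _root_.ResolutionOfSingularities

-- `Assembly` holds: proved by `Summit.ResolutionOfSingularities.ResolutionOfSingularities.Theorems.wildQuotients_assembly_proof` @ 45d0da0f4e93 (its module imports this route file, so no `_holds` link can be stated here).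

/-! D-0027 §2.1 — DECIDING THEOREM (planner-authored via `route open/edit --closes-file`; by planner-rrepair-ResolutionOfSingularities-Wild-646df16e-0 2026-08-16T16:32:44Z):
its hypotheses are this route's items and its conclusion the sub-problem Statement (glue_lint), and it elaborates with this file. -/

/-- D-0027 §2.1 deciding theorem of route WildQuotients (rev 2, cone repair): the three CRUXES imply the summit
statement `ResolutionOfSingularities` (by name) by pure logic — fix a prime `p`; `SummitReduction p hp` consumes
`WildQuotientResolution` and `Picover` specialised at `p` (its antecedents are their bodies verbatim) and yields
`ResolutionInChar p`; `ResolutionOfSingularities_iff` (Statement file) folds the primes back into the summit.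
No Literature / Theorems module is imported by this file: the de Jong reduction and pAlteration's PROVED per-prime
frame (`Theorems.hasResolution_of_thesis`, `PAlteration.DescentReducedToIntegral_holds`) live INSIDE the crux
`SummitReduction`, whose prover imports them in a Theorems file. -/
@[closes "route-ResolutionOfSingularities-WildQuotients"] theorem closes (hWQ : WildQuotientResolution) (hPc : Picover) (hSR : SummitReduction) :
    _root_.ResolutionOfSingularities :=
  _root_.ResolutionOfSingularities_iff.mpr fun p hp => hSR p hp (hWQ p hp) (hPc p hp)

end Summit.ResolutionOfSingularities.ResolutionOfSingularities.Theses.WildQuotients
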